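import Summits.HubbardSuperconductivity.HubbardSuperconductivity.Theses.AbelianDuality
import Summits.HubbardSuperconductivity.HubbardSuperconductivity.Theorems.LogColdTorusAverageToEveryRecut
import HarnessLib

/-!
# Route `AbelianDuality`, hub crux `AverageToEvery` (item `stmt-HubbardSuperconductivity-10519`, shared with route
`LogColdTorus`): the conjugate-source RE-CUT of this route is dominated by its two items

Helper (`--supports`) for the shared crux (decl `Summit.HubbardSuperconductivity.HubbardSuperconductivity.Theses.AbelianDuality.AverageToEvery`,
Iff.rfl-equal to `…Theses.LogColdTorus.AverageToEvery`). Plan-level fact (D-0014), companion of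
`Theorems/LogColdTorusAverageToEveryRecut.lean`:

* `shiftedThesis_of_thesis_of_averageToEvery` — `AbelianDuality.Thesis → AbelianDuality.AverageToEvery →
  ShiftedThesis`, where `ShiftedThesis` (written out) is VERBATIM the hypothesis of the landed closer
  `Theorems.shiftedAverageSummit : ShiftedThesis → HubbardSuperconductivity` (the shifted ground-state
  average of `Δ_d† Δ_d` at ONE `(δ, U)`, `∃ κ > 0` per side, for `hubbardTorus 2 L 1 U + κ L⁻⁴ Δ_d† Δ_d`).
  So the route `AbelianDuality` may replace BOTH its items (`Thesis`, window GS-average order, and the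
  every-ground-state crux) by the ONE item `ShiftedThesis`, with closes body `shiftedAverageSummit`:
  the new item is implied by the old pair (this theorem) and closes the route alone (the closer); the
  window of couplings — demanded only for the every-GS upgrade — disappears.

Griffiths, J. Math. Phys. 5 (1964) 1215 §III; Scalapino, Phys. Rep. 250 (1995) 329 §2. Folklore
bookkeeping over landed theorems; no definition and no named fact is introduced.
-/

noncomputable section

-- `dupNamespace`: the summit and the problem are both named `HubbardSuperconductivity` (layout D-0022)
set_option linter.dupNamespace false

namespace Summit.HubbardSuperconductivity.HubbardSuperconductivity.Theorems

open Matrix Finset Filter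
open Literature.Probability.LatticeModels Literature.MathematicalPhysics.QuantumLattice
open scoped ComplexOrder Matrix Classical

/-- **`Thesis ∧ AverageToEvery ⇒ ShiftedThesis` (route `AbelianDuality`).** From the hub `Thesis`
(window ground-state-average `d`-wave order at some `δ ∈ (0, 1/2)`, uniform threshold) and the
every-ground-state upgrade `AverageToEvery` (Iff.rfl-equal to the `LogColdTorus` decl, so
`averageToEvery_iff_transfer` applies verbatim): at one coupling `U` of the window every normalised
sector ground state carries `a L⁴` of `Δ_d† Δ_d` eventually in even `L`, hence
(`exists_shiftedAverage_of_forall_groundState_bound`) some `κ > 0` per side carries the SHIFTED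
ground-state-average bound with constant `a/4` — the hypothesis of `shiftedAverageSummit`, word for
word. Griffiths (1964) §III; Tasaki (2020) §2.2. [folklore] -/
theorem shiftedThesis_of_thesis_of_averageToEvery : Summit.HubbardSuperconductivity.HubbardSuperconductivity.Theses.AbelianDuality.Thesis → Summit.HubbardSuperconductivity.HubbardSuperconductivity.Theses.AbelianDuality.AverageToEvery → (∃ δ ∈ Set.Ioo (0:ℝ) (1/2), ∃ U : ℝ, 0 < U ∧ ∃ c : ℝ, 0 < c ∧ ∃ L₀ : ℕ, ∀ (L : ℕ) [NeZero L], L₀ ≤ L → Even L → ∃ κ : ℝ, 0 < κ ∧ let N : ℕ := 2 * ⌊(1 - δ) * (L : ℝ) ^ 2 / 2⌋₊; let H := hubbardTorus 2 L 1 U; let S := szSector (Λ := FermionTorus 2 L) N 0; let Yd : Matrix (Finset (Orb (FermionTorus 2 L))) (Finset (Orb (FermionTorus 2 L))) ℂ := ((1 : ℂ) / (L : ℂ) ^ 4) • ((pairField dWaveFormFactor L)ᴴ * pairField dWaveFormFactor L); let E := S ⊓ Module.End.eigenspace (Matrix.toLin' (H + (κ : ℂ) • Yd)) ((((H + (κ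 : ℂ) • Yd).minEnergyOn S : ℝ)) : ℂ); let P := projMatrix (E.map (Fock.toEuclidean (ι := Orb (FermionTorus 2 L)) : Fock (Orb (FermionTorus 2 L)) →ₗ[ℂ] EuclideanSpace ℂ (Finset (Orb (FermionTorus 2 L))))); c * (L : ℝ) ^ 4 * P.trace.re ≤ (P * ((pairField dWaveFormFactor L)ᴴ * pairField dWaveFormFactor L)).trace.re) := by
  intro hT hA
  obtain ⟨δ, hδ, U₁, U₂, hU₁, hU₁₂, c, hc, L₀, h⟩ := hT
  have hA' : Summit.HubbardSuperconductivity.HubbardSuperconductivity.Theses.LogColdTorus.AverageToEvery := hA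
  obtain ⟨U, hU, a, ha, L₁, hGS⟩ := averageToEvery_iff_transfer.1 hA' δ U₁ U₂ c L₀ hU₁ hU₁₂ hc
    (fun U hU L _ hL hLe => h U hU L hL hLe)
  exact ⟨δ, hδ, U, lt_trans hU₁ hU.1, a / 4, by positivity, L₁, fun L _ hL hLe =>
    exists_shiftedAverage_of_forall_groundState_bound L U δ a ha (hGS L hL hLe)⟩

/-- **Sanity composition (route `AbelianDuality`): the re-cut item closes the route alone.** The
closes body after the re-cut is the landed `shiftedAverageSummit`; composed with
`shiftedThesis_of_thesis_of_averageToEvery` it re-derives the route's present `closes`. [folklore] -/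
theorem hubbardSuperconductivity_of_thesis_of_averageToEvery_via_shift
    (hT : Summit.HubbardSuperconductivity.HubbardSuperconductivity.Theses.AbelianDuality.Thesis)
    (hA : Summit.HubbardSuperconductivity.HubbardSuperconductivity.Theses.AbelianDuality.AverageToEvery) :
    HubbardSuperconductivity :=
  hubbardSuperconductivity_of_shiftedAverage (shiftedThesis_of_thesis_of_averageToEvery hT hA)

end Summit.HubbardSuperconductivity.HubbardSuperconductivity.Theorems

end
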